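import Summits.HubbardSuperconductivity.HubbardSuperconductivity.Theorems.BalabanIRBirComplexStableXYRTEndPowerAsymptotics
import Summits.HubbardSuperconductivity.HubbardSuperconductivity.Theorems.BalabanIRBirComplexStableXYRTEndTraceNormBound
import Summits.HubbardSuperconductivity.HubbardSuperconductivity.Theorems.BalabanIRBirComplexStableXYRTEndTraceRankOne
import HarnessLib

/-!
# Crux `BirComplexStableXYR`, chapter T-end (lead c8): trace asymptotics of the perturbed chain

Helper file (`--supports stmt-HubbardSuperconductivity-14845`).  The T-end lemma with the dressed projector EXPOSED in rank-one form
(`tEnd_powerAsymptotics_rankOne`: same assembly of T1–T5 as `tEnd_powerAsymptotics`, but returning the dressed vectors `x, ψ` with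
`p = ψ(x)⁻¹ψ(·)x`), and its trace corollary on a finite-dimensional complex Hilbert space (`stub_tEndTraceAsymptotics`, registered T11):
`|tr tⁿ − μⁿ| ≤ (dim E)·θ₁ⁿ` for all `n ≥ 1`, `θ₁ = θ + 200ε(‖t‖+1)/(1−θ)` (T9 `stub_traceNormBound`, T10 `stub_traceRankOne`).
With `μ` real (T8) and `θ₁ < μ`: `Re tr tⁿ > 0` for all `n ≥ n₀(dim E)` — the partition function of a `d`-sector truncation of the
effective rotor chain keeps its sign for every chain length.  Sorry-free; no definition, no named fact. [folklore; Kato §II.1]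
-/

set_option linter.dupNamespace false -- `Summit.<S>.<S>.Theorems…` repeats the summit name (D-0017 layout)

noncomputable section

namespace Summit.HubbardSuperconductivity.HubbardSuperconductivity.Theorems.TEnd

/-- **T-end lemma, rank-one form.**  As `tEnd_powerAsymptotics`, returning the dressed right/left eigenvectors `x, ψ` (`ψ x ≠ 0`)
so that the dressed projector is literally `p = (ψ x)⁻¹ • ψ.smulRight x`. -/
theorem tEnd_powerAsymptotics_rankOne (E : Type) [NormedAddCommGroup E] [NormedSpace ℂ E] [CompleteSpace E]
    (t : E →L[ℂ] E) (e : E) (φ : E →L[ℂ] ℂ) (θ ε : ℝ)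
    (he : ‖e‖ ≤ 1) (hφ : ‖φ‖ ≤ 1) (hφe : φ e = 1) (hθ0 : 0 ≤ θ) (hθ1 : θ < 1) (hε0 : 0 ≤ ε) (hε : 16 * ε ≤ 1 - θ)
    (hM : ‖((1 : E →L[ℂ] E) - φ.smulRight e) * t * ((1 : E →L[ℂ] E) - φ.smulRight e)‖ ≤ θ)
    (hb : ‖φ.comp (t * ((1 : E →L[ℂ] E) - φ.smulRight e))‖ ≤ ε)
    (hc : ‖((1 : E →L[ℂ] E) - φ.smulRight e) (t e)‖ ≤ ε)
    (ha : ‖φ (t e) - 1‖ ≤ ε) :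
    ∃ (μ : ℂ) (x : E) (ψ : E →L[ℂ] ℂ), ‖μ - 1‖ ≤ 2 * ε ∧
      μ = φ (t e) + (φ.comp (t * ((1 : E →L[ℂ] E) - φ.smulRight e)))
        (Ring.inverse (μ • (1 : E →L[ℂ] E) - ((1 : E →L[ℂ] E) - φ.smulRight e) * t * ((1 : E →L[ℂ] E) - φ.smulRight e))
          (((1 : E →L[ℂ] E) - φ.smulRight e) (t e))) ∧
      ψ x ≠ 0 ∧
      t * ((ψ x)⁻¹ • ψ.smulRight x) = μ • ((ψ x)⁻¹ • ψ.smulRight x) ∧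
      ∀ n : ℕ, 1 ≤ n → ‖t ^ n - μ ^ n • ((ψ x)⁻¹ • ψ.smulRight x)‖ ≤ (θ + 200 * ε / (1 - θ) * (‖t‖ + 1)) ^ n := by
  set q₀ : E →L[ℂ] E := (1 : E →L[ℂ] E) - φ.smulRight e with hq₀
  set M : E →L[ℂ] E := q₀ * t * q₀ with hMdef
  set b : E →L[ℂ] ℂ := φ.comp (t * q₀) with hbdef
  set c : E := q₀ (t e) with hcdef
  set a : ℂ := φ (t e) with hadef
  have h4ε : 4 * ε ≤ 1 - θ := by linarith
  have hR : ∀ μ : ℂ, θ < ‖μ‖ → IsUnit (μ • (1 : E →L[ℂ] E) - M) ∧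
      ‖Ring.inverse (μ • (1 : E →L[ℂ] E) - M)‖ ≤ 1 / (‖μ‖ - θ) :=
    fun μ hμ => stub_resolventBound E M θ hM μ hμ
  obtain ⟨μ, ⟨hμ1, hfix⟩, _⟩ :=
    stub_feshbachFixedPoint E M b c a θ ε hθ0 hθ1 hε0 h4ε hM hb hc ha hR
  set R : E →L[ℂ] E := Ring.inverse (μ • (1 : E →L[ℂ] E) - M) with hRdef
  have hμge : 1 - 2 * ε ≤ ‖μ‖ := by
    have h2 : ‖(1 : ℂ)‖ - ‖μ‖ ≤ ‖(1 : ℂ) - μ‖ := norm_sub_norm_le (1 : ℂ) μ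
    rw [norm_one, norm_sub_rev] at h2
    linarith
  have hμnorm : θ < ‖μ‖ := by linarith
  have hμ0 : μ ≠ 0 := by
    intro h; rw [h, norm_zero] at hμnorm; linarith
  have hU : IsUnit (μ • (1 : E →L[ℂ] E) - M) := (hR μ hμnorm).1
  have h1θ : 0 < 1 - θ := by linarith
  have hRle : ‖R‖ ≤ 2 / (1 - θ) := by
    have h2 : (1 - θ) / 2 ≤ ‖μ‖ - θ := by linarith
    have h3 : 0 < (1 - θ) / 2 := by linarith
    calc ‖R‖ ≤ 1 / (‖μ‖ - θ) := (hR μ hμnorm).2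
      _ ≤ 1 / ((1 - θ) / 2) := one_div_le_one_div_of_le h3 h2
      _ = 2 / (1 - θ) := by rw [one_div_div]
  obtain ⟨htx, hψt, hψx⟩ := stub_dressedEigenvectors E t e φ hφe μ hμ0 hU hfix
  set x : E := e + R c with hxdef
  set ψ : E →L[ℂ] ℂ := φ + b.comp R with hψdef
  set δ : ℝ := 2 * ε / (1 - θ) with hδdef
  have hδ0 : 0 ≤ δ := div_nonneg (by linarith) h1θ.le
  have hδ8 : δ ≤ 1 / 8 := by rw [hδdef, div_le_iff₀ h1θ]; linarith
  have hv : ‖R c‖ ≤ δ := by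
    calc ‖R c‖ ≤ ‖R‖ * ‖c‖ := R.le_opNorm c
      _ ≤ 2 / (1 - θ) * ε := mul_le_mul hRle hc (norm_nonneg _) (div_nonneg (by norm_num) h1θ.le)
      _ = δ := by rw [hδdef]; ring
  have hw : ‖b.comp R‖ ≤ δ := by
    calc ‖b.comp R‖ ≤ ‖b‖ * ‖R‖ := b.opNorm_comp_le R
      _ ≤ ε * (2 / (1 - θ)) := mul_le_mul hb hRle (norm_nonneg _) hε0
      _ = δ := by rw [hδdef]; ring
  obtain ⟨hψx1, _, _, hpow⟩ := stub_complementDecay E t e φ (R c) (b.comp R) θ δ he hφ hφe hδ0 hδ8 hv hw hM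
  have hψx0 : ψ x ≠ 0 := by
    intro h0
    have h1 : ‖(φ + b.comp R) (e + R c) - 1‖ ≤ 3 * δ := hψx1
    have h2 : (φ + b.comp R) (e + R c) = 0 := h0
    rw [h2, zero_sub, norm_neg, norm_one] at h1
    linarith
  obtain ⟨_, htp, _, hpowers⟩ := stub_projectorPowers E t x ψ μ htx hψt hψx0
  refine ⟨μ, x, ψ, hμ1, hfix, hψx0, htp, fun n hn => ?_⟩
  rw [hpowers n hn, add_sub_cancel_left]
  calc ‖(((1 : E →L[ℂ] E) - (ψ x)⁻¹ • ψ.smulRight x) * t * ((1 : E →L[ℂ] E) - (ψ x)⁻¹ • ψ.smulRight x)) ^ n‖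
      ≤ (θ + 100 * δ * (‖t‖ + 1)) ^ n := hpow n
    _ = (θ + 200 * ε / (1 - θ) * (‖t‖ + 1)) ^ n := by rw [hδdef]; ring

/-- **Stub T11 `stub_tEndTraceAsymptotics` (registered): trace asymptotics of the perturbed chain.**  On a finite-dimensional complex
Hilbert space, under the hypotheses of the T-end lemma: there is `μ` with `|μ − 1| ≤ 2ε` (the Feshbach fixed point) such that for all
`n ≥ 1`, `|tr tⁿ − μⁿ| ≤ (dim E)·(θ + 200ε(‖t‖+1)/(1−θ))ⁿ` (`tⁿ = μⁿp + rⁿ`, `tr p = 1`, `|tr rⁿ| ≤ dim E·‖rⁿ‖`). -/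
theorem stub_tEndTraceAsymptotics :
    ∀ (E : Type) [NormedAddCommGroup E] [InnerProductSpace ℂ E] [FiniteDimensional ℂ E]
      (t : E →L[ℂ] E) (e : E) (φ : E →L[ℂ] ℂ) (θ ε : ℝ),
      ‖e‖ ≤ 1 → ‖φ‖ ≤ 1 → φ e = 1 → 0 ≤ θ → θ < 1 → 0 ≤ ε → 16 * ε ≤ 1 - θ →
      ‖((1 : E →L[ℂ] E) - φ.smulRight e) * t * ((1 : E →L[ℂ] E) - φ.smulRight e)‖ ≤ θ →
      ‖φ.comp (t * ((1 : E →L[ℂ] E) - φ.smulRight e))‖ ≤ ε →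
      ‖((1 : E →L[ℂ] E) - φ.smulRight e) (t e)‖ ≤ ε → ‖φ (t e) - 1‖ ≤ ε →
      ∃ μ : ℂ, ‖μ - 1‖ ≤ 2 * ε ∧
        μ = φ (t e) + (φ.comp (t * ((1 : E →L[ℂ] E) - φ.smulRight e)))
          (Ring.inverse (μ • (1 : E →L[ℂ] E) - ((1 : E →L[ℂ] E) - φ.smulRight e) * t * ((1 : E →L[ℂ] E) - φ.smulRight e))
            (((1 : E →L[ℂ] E) - φ.smulRight e) (t e))) ∧
        ∀ n : ℕ, 1 ≤ n →
          ‖LinearMap.trace ℂ E ((t ^ n : E →L[ℂ] E) : E →ₗ[ℂ] E) - μ ^ n‖ ≤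
            (Module.finrank ℂ E : ℝ) * (θ + 200 * ε / (1 - θ) * (‖t‖ + 1)) ^ n := by
  intro E _ _ _ t e φ θ ε he hφ hφe hθ0 hθ1 hε0 hε hM hb hc ha
  haveI : CompleteSpace E := FiniteDimensional.complete ℂ E
  obtain ⟨μ, x, ψ, hμ1, hfix, hψx0, _, hpow⟩ :=
    tEnd_powerAsymptotics_rankOne E t e φ θ ε he hφ hφe hθ0 hθ1 hε0 hε hM hb hc ha
  refine ⟨μ, hμ1, hfix, fun n hn => ?_⟩
  set p : E →L[ℂ] E := (ψ x)⁻¹ • ψ.smulRight x with hpdef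
  -- tr p = 1
  have htrp : LinearMap.trace ℂ E (p : E →ₗ[ℂ] E) = 1 := stub_traceRankOne E x ψ hψx0
  -- tr tⁿ − μⁿ = tr (tⁿ − μⁿ p)
  have hdiff : LinearMap.trace ℂ E ((t ^ n : E →L[ℂ] E) : E →ₗ[ℂ] E) - μ ^ n =
      LinearMap.trace ℂ E ((t ^ n - μ ^ n • p : E →L[ℂ] E) : E →ₗ[ℂ] E) := by
    rw [ContinuousLinearMap.toLinearMap_sub, map_sub, ContinuousLinearMap.toLinearMap_smul, map_smul, htrp, smul_eq_mul, mul_one]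
  rw [hdiff]
  calc ‖LinearMap.trace ℂ E ((t ^ n - μ ^ n • p : E →L[ℂ] E) : E →ₗ[ℂ] E)‖
      ≤ (Module.finrank ℂ E : ℝ) * ‖t ^ n - μ ^ n • p‖ := stub_traceNormBound E (t ^ n - μ ^ n • p)
    _ ≤ (Module.finrank ℂ E : ℝ) * (θ + 200 * ε / (1 - θ) * (‖t‖ + 1)) ^ n :=
        mul_le_mul_of_nonneg_left (hpow n hn) (Nat.cast_nonneg _)

end Summit.HubbardSuperconductivity.HubbardSuperconductivity.Theorems.TEnd

end
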